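import Literature.NumberTheory.GaloisCohomology.ShaRestrictedLayerLocalLimit
import Literature.NumberTheory.GaloisRepresentations.ContinuousCohomologyConjIsLocNil
import HarnessLib

/-!
# `Шⁿ_S` of the layers in degree `2`: the conjugations (multiplicative, inner ones trivial, commuting modulo the layer),
# the localisation INTERTWINING the global and the local conjugations, and the vanishing at the complex places

Topic `Literature/NumberTheory/GaloisCohomology` (namespace `Literature.NumberTheory.GaloisCohomology.ShaLayer`; §0 in
`Literature.NumberTheory.GaloisRepresentations`).  Degree-`2` (and degree-generic) sequel of `ShaRestrictedLayerLocalLimit.lean`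
(cf2c-w8 g8, degree `1`).  Cell `bsd-print-cf2`, width seat `bsd-line-cf2c-w8` g9: bookkeeping for the LOCAL plug (π4b) of ROW 1 of
Johnson-Leung–Kings' Lemma 5.8 (the cokernel of the class-group row lives in the local `H²`'s of the layers).  THEOREMS ONLY (no
definition, no named fact, no instance, no `sorry`).

SETTING.  `K` a number field, `S` a set of finite places, `N_S ≤ Γ_K` the ramification subgroup, `G_S = Γ_K ⧸ N_S`, `π` the
projection, `V ⊴ Γ_K` (a layer, `V̄ = V.map π`), `X = M′^{N_S}` the `G_S`-module of a discrete `Γ_K`-module `ρ` on `M′`,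
`φ_v = π ∘ res_v : Γ_{K_v} → G_S` (`ShaLayer.locHom v`), local groups `φ_v⁻¹V̄ ≤ Γ_{K_v}`.

* §0 `map_comap_conjMap` (generic: topological groups `D → G`, `N ⊴ G`, a `G`-representation `X`, every degree): the pull-back
  `Hⁿ(N, X) → Hⁿ(φ⁻¹N, res_φ X)` intertwines `conj_{φ δ}` with `conj_δ` (both composites are Mathlib's `ContinuousCohomology.map`
  along ONE compatible pair; the tree's `map_comp_apply_of`).
* §1 `layerConj_mul_deg` (every degree), `layerConj_eq_self_of_mem_two`, `layerConj_comm_two`, `layerLocalization_inr_eq_deg`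
  (`rfl`), **`layerLocalization_layerConj_locHom`** (`loc_v ∘ conj_{φ_v δ} = conj_δ ∘ loc_v`, every degree),
  `layerLocalization_inl_eq_zero_two` (complex places: `Γ_ℂ = 1`).

HONEST FRAMING: Galois-cohomological bookkeeping; no duality, no main conjecture, no BSD; no summit statement is proved by this seat.

## References
* J.-P. Serre, *Local Fields* (1979), VII §5 Prop. 3; *Galois Cohomology* (1997), I §2.4, II §6.3. [SerreLocalFields1979] [SerreGaloisCohomology1997]
* J. S. Milne, *Arithmetic Duality Theorems* (2006), I §4 (p. 56), I Thm. 4.10 (a). [MilneADT2006]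
* D. Harari, *Galois Cohomology and Class Field Theory* (2020), §17.2 (p. 290). [Harari2020]
-/

noncomputable section

open scoped NumberField
open CategoryTheory Function Field IsDedekindDomain NumberField
open Literature.NumberTheory.GaloisRepresentations
open Literature.NumberTheory.GaloisRepresentations.DiscreteGaloisModule
open Literature.NumberTheory.EllipticCurves

/-! ## §0 Pulling back to a subgroup of another group intertwines the conjugations (every degree) -/

namespace Literature.NumberTheory.GaloisRepresentations

section ComapConj

universe u v

variable {R : Type u} [CommRing R] [TopologicalSpace R]
variable {G : Type v} [Group G] [TopologicalSpace G] [IsTopologicalGroup G]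
variable {D : Type v} [Group D] [TopologicalSpace D] [IsTopologicalGroup D]
variable (X : TopRep.{v} R G) (N : Subgroup G) [N.Normal] (φ : D →ₜ* G)

/-- **Pull-back along `φ : D → G` to `φ⁻¹N` intertwines `conj_{φ δ}` on `Hⁿ(N, X)` with `conj_δ` on `Hⁿ(φ⁻¹N, res_φ X)`**
(both composites are `ContinuousCohomology.map` along the pair `(x ↦ (φδ)⁻¹ φ(x) (φδ) = φ(δ⁻¹ x δ), v ↦ (φ δ)·v)`).
[cite: SerreLocalFields1979, VII §5 Prop. 3] -/
theorem map_comap_conjMap (δ : D) (n : ℕ) (z : continuousCohomology n (subgroupRep X N)) :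
    ContinuousCohomology.map (comapSubtypeHom N φ) (comapCoeffHom X N φ) n (conjMap X N (φ δ) n z) =
      conjMap (TopRep.res (φ : D →* G) X) (N.comap (φ : D →* G)) δ n
        (ContinuousCohomology.map (comapSubtypeHom N φ) (comapCoeffHom X N φ) n z) := by
  -- the module half `v ↦ φ(δ)·v` of the common compatible pair
  let hδ : TopRep.res (((subgroupConj N (φ δ)).comp (comapSubtypeHom N φ) : N.comap (φ : D →* G) →ₜ* N) :
        N.comap (φ : D →* G) →* N) (subgroupRep X N) ⟶ subgroupRep (TopRep.res (φ : D →* G) X) (N.comap (φ : D →* G)) :=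
    TopRep.ofHom ⟨X.ρ (φ δ), fun x => by
      ext w
      change X.ρ (φ δ) (X.ρ ((φ δ)⁻¹ * φ (x : D) * φ δ) w) = X.ρ (φ (x : D)) (X.ρ (φ δ) w)
      rw [mul_assoc, ρ_mul_apply, ρ_apply_ρ_inv_apply, ρ_mul_apply]⟩
  have h1 : ContinuousCohomology.map ((subgroupConj N (φ δ)).comp (comapSubtypeHom N φ)) hδ n z =
      ContinuousCohomology.map (comapSubtypeHom N φ) (comapCoeffHom X N φ) n (conjMap X N (φ δ) n z) :=
    map_comp_apply_of (subgroupConj N (φ δ)) (comapSubtypeHom N φ) _ (fun _ => rfl)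
      (conjRepHom X N (φ δ)) (comapCoeffHom X N φ) hδ (fun _ => rfl) n z
  have h2 : ContinuousCohomology.map ((subgroupConj N (φ δ)).comp (comapSubtypeHom N φ)) hδ n z =
      conjMap (TopRep.res (φ : D →* G) X) (N.comap (φ : D →* G)) δ n
        (ContinuousCohomology.map (comapSubtypeHom N φ) (comapCoeffHom X N φ) n z) := by
    refine map_comp_apply_of (comapSubtypeHom N φ) (subgroupConj (N.comap (φ : D →* G)) δ) _ (fun x => ?_)
      (comapCoeffHom X N φ) (conjRepHom (TopRep.res (φ : D →* G) X) (N.comap (φ : D →* G)) δ)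
      hδ (fun _ => rfl) n z
    apply Subtype.ext
    change (φ δ)⁻¹ * φ (x : D) * φ δ = φ (δ⁻¹ * (x : D) * δ)
    rw [map_mul, map_mul, map_inv]
  rw [← h1, h2]

end ComapConj

end Literature.NumberTheory.GaloisRepresentations

/-! ## §1 Layer lemmas in degree `2`: conjugations, localisation, complex places -/

namespace Literature.NumberTheory.GaloisCohomology.ShaLayer

variable {K : Type} [Field K] [NumberField K] (S : Set (HeightOneSpectrum (𝓞 K)))
variable {M' : Type} [AddCommGroup M'] [TopologicalSpace M'] [DiscreteTopology M'] (ρ : DiscreteGaloisModule K M')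
variable {V : Subgroup (absoluteGaloisGroup K)} [V.Normal]

omit [NumberField K] in
/-- **Multiplicativity of the layer conjugations in every degree**: `conj_{στ} = conj_σ ∘ conj_τ` (`conjMap_conjMap`).
[cite: SerreLocalFields1979, VII §5 Prop. 3] -/
theorem layerConj_mul_deg (σ τ : GaloisGroupUnramifiedOutside K S) (n : ℕ)
    (z : continuousCohomology n (subgroupRep (ρ.quotientInvariants (ramificationSubgroup K S)).toTopRep
        (V.map (toUnramifiedQuot K S)))) :
    layerConj S ρ V (σ * τ) n z = layerConj S ρ V σ n (layerConj S ρ V τ n z) := by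
  rw [layerConj_apply, layerConj_apply, layerConj_apply]
  exact (conjMap_conjMap _ _ τ σ n z).symm

/-- **Inner conjugations act trivially on `H²` of the layer**: for `σ ∈ V̄`, `conj_σ z = z` (`conjMap_eq_self_of_mem_two`).
[cite: SerreLocalFields1979, VII §5 Prop. 3] -/
theorem layerConj_eq_self_of_mem_two (hV : IsOpen (V : Set (absoluteGaloisGroup K)))
    {σ : GaloisGroupUnramifiedOutside K S} (hσ : σ ∈ V.map (toUnramifiedQuot K S))
    (z : continuousCohomology 2 (subgroupRep (ρ.quotientInvariants (ramificationSubgroup K S)).toTopRep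
        (V.map (toUnramifiedQuot K S)))) :
    layerConj S ρ V σ 2 z = z := by
  haveI : LocallyCompactSpace (V.map (toUnramifiedQuot K S)) :=
    (Subgroup.isClosed_of_isOpen _ (isOpen_map_toUnramifiedQuot S V hV)).locallyCompactSpace
  rw [layerConj_apply]
  exact conjMap_eq_self_of_mem_two _ _ hσ z

/-- **Conjugations commute on `H²` of the layer when their commutator lies in `V̄`** (`conjMap_comm_of_commutator_mem_two`).
[cite: SerreLocalFields1979, VII §5 Prop. 3] -/
theorem layerConj_comm_two (hV : IsOpen (V : Set (absoluteGaloisGroup K)))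
    {σ τ : GaloisGroupUnramifiedOutside K S} (hc : σ * τ * σ⁻¹ * τ⁻¹ ∈ V.map (toUnramifiedQuot K S))
    (z : continuousCohomology 2 (subgroupRep (ρ.quotientInvariants (ramificationSubgroup K S)).toTopRep
        (V.map (toUnramifiedQuot K S)))) :
    layerConj S ρ V σ 2 (layerConj S ρ V τ 2 z) = layerConj S ρ V τ 2 (layerConj S ρ V σ 2 z) := by
  haveI : LocallyCompactSpace (V.map (toUnramifiedQuot K S)) :=
    (Subgroup.isClosed_of_isOpen _ (isOpen_map_toUnramifiedQuot S V hV)).locallyCompactSpace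
  rw [layerConj_apply, layerConj_apply, layerConj_apply, layerConj_apply]
  exact conjMap_comm_of_commutator_mem_two _ _ hc z

omit [V.Normal] in
/-- The tree's `layerLocalization` at a finite place is the pull-back along `φ_v⁻¹V̄ → V̄`, in every degree (definitional).
[cite: Harari2020, §17.2 (p. 290)] -/
theorem layerLocalization_inr_eq_deg (v : HeightOneSpectrum (𝓞 K)) (n : ℕ)
    (z : continuousCohomology n (subgroupRep (ρ.quotientInvariants (ramificationSubgroup K S)).toTopRep
        (V.map (toUnramifiedQuot K S)))) :
    layerLocalization S ρ V (Sum.inr v) n z =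
      (ContinuousCohomology.map (comapSubtypeHom (V.map (toUnramifiedQuot K S)) (locHom (S := S) v))
        (comapCoeffHom (ρ.quotientInvariants (ramificationSubgroup K S)).toTopRep (V.map (toUnramifiedQuot K S))
          (locHom (S := S) v)) n).hom z := rfl

/-- **The layer localisation at a finite place intertwines the conjugation by `φ_v δ` (`δ ∈ Γ_{K_v}`) with the LOCAL
conjugation by `δ` on `Hⁿ(φ_v⁻¹V̄, ·)`.** [cite: SerreLocalFields1979, VII §5 Prop. 3] [cite: MilneADT2006, I §4 (p. 56)] -/
theorem layerLocalization_layerConj_locHom (v : HeightOneSpectrum (𝓞 K)) (δ : absoluteGaloisGroup (v.adicCompletion K)) (n : ℕ)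
    (z : continuousCohomology n (subgroupRep (ρ.quotientInvariants (ramificationSubgroup K S)).toTopRep
        (V.map (toUnramifiedQuot K S)))) :
    layerLocalization S ρ V (Sum.inr v) n (layerConj S ρ V (locHom (S := S) v δ) n z) =
      (conjMap (TopRep.res (locHom (S := S) v : absoluteGaloisGroup (v.adicCompletion K) →* GaloisGroupUnramifiedOutside K S)
          (ρ.quotientInvariants (ramificationSubgroup K S)).toTopRep)
        ((V.map (toUnramifiedQuot K S)).comap
          (locHom (S := S) v : absoluteGaloisGroup (v.adicCompletion K) →* GaloisGroupUnramifiedOutside K S)) δ n).hom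
        (layerLocalization S ρ V (Sum.inr v) n z) := by
  rw [layerLocalization_inr_eq_deg, layerLocalization_inr_eq_deg, layerConj_apply]
  exact map_comap_conjMap (ρ.quotientInvariants (ramificationSubgroup K S)).toTopRep (V.map (toUnramifiedQuot K S))
    (locHom (S := S) v) δ n z

omit [V.Normal] in
/-- **At a complex place every layer localisation vanishes in degree `2`** (`Γ_{K_w} = 1`: a `2`-cocycle of a subgroup of the
trivial group is the coboundary of the constant cochain `f(1,1)`). [cite: SerreGaloisCohomology1997, II §6.3] [cite: MilneADT2006, I Thm. 4.10 (a) (archimedean factors)] -/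
theorem layerLocalization_inl_eq_zero_two (hV : IsOpen (V : Set (absoluteGaloisGroup K))) {w : InfinitePlace K} (hw : w.IsComplex)
    (z : continuousCohomology 2 (subgroupRep (ρ.quotientInvariants (ramificationSubgroup K S)).toTopRep
        (V.map (toUnramifiedQuot K S)))) :
    layerLocalization S ρ V (Sum.inl w) 2 z = 0 := by
  haveI : LocallyCompactSpace (V.map (toUnramifiedQuot K S)) :=
    (Subgroup.isClosed_of_isOpen _ (isOpen_map_toUnramifiedQuot S V hV)).locallyCompactSpace
  haveI : CompactSpace (absoluteGaloisGroup (Place.Completion (Sum.inl w : Place K))) := absoluteGaloisGroup_compactSpace _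
  haveI : LocallyCompactSpace ((V.map (toUnramifiedQuot K S)).comap
      (RestrictedExt.localizationHom K S (Sum.inl w) :
        absoluteGaloisGroup (Place.Completion (Sum.inl w : Place K)) →* GaloisGroupUnramifiedOutside K S)) :=
    (((Subgroup.isClosed_of_isOpen _ (isOpen_map_toUnramifiedQuot S V hV))).preimage
      (RestrictedExt.localizationHom K S (Sum.inl w)).continuous_toFun).locallyCompactSpace
  obtain ⟨c, rfl⟩ := twoCocycleClass_surjective _ z
  change ContinuousCohomology.map (comapSubtypeHom (V.map (toUnramifiedQuot K S)) (RestrictedExt.localizationHom K S (Sum.inl w)))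
    (comapCoeffHom (ρ.quotientInvariants (ramificationSubgroup K S)).toTopRep (V.map (toUnramifiedQuot K S))
      (RestrictedExt.localizationHom K S (Sum.inl w))) 2 (twoCocycleClass _ c) = 0
  rw [map_twoCocycleClass, twoCocycleClass_eq_zero_iff]
  refine ⟨ContinuousMap.const _ ((contTwoCocycles.pullback
    (comapSubtypeHom (V.map (toUnramifiedQuot K S)) (RestrictedExt.localizationHom K S (Sum.inl w)))
    (comapCoeffHom (ρ.quotientInvariants (ramificationSubgroup K S)).toTopRep (V.map (toUnramifiedQuot K S))
      (RestrictedExt.localizationHom K S (Sum.inl w))) c).1 (1, 1)), fun σ τ => ?_⟩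
  have hσ : σ = 1 := Subtype.ext (eq_one_absoluteGaloisGroup_of_isComplex hw _)
  have hτ : τ = 1 := Subtype.ext (eq_one_absoluteGaloisGroup_of_isComplex hw _)
  subst hσ; subst hτ
  simp only [ContinuousMap.const_apply, map_one, mul_one, one_apply_eq_self]
  abel

end Literature.NumberTheory.GaloisCohomology.ShaLayer

end
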